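import Mathlib
import Literature.Probability.Moments.HoeffdingDecomposition
import HarnessLib

/-!
# The resampling (noise) operator on a set of coordinates through the Hoeffding decomposition

Continuation of `Literature/Probability/Moments/HoeffdingDecomposition.lean` (O'Donnell 2014,
§8.3–8.4; Efron–Stein 1981), counting form on a finite product space `ι → Γ` with the uniform
(counting) measure, for an arbitrary SET `T` of resampled coordinates instead of a single one:

* `dependsOn_hoeffdingComp` — the component `F^{=S}` is an `S`-junta;
* `coordAvg_hoeffdingComp` — the averaging operator `E_T` kills `F^{=S}` when `S` meets `T` and
  fixes it otherwise (O'Donnell 2014, Prop. 8.36); hence the **noise-operator formula**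
  `E_T F = Σ_{S ∩ T = ∅} F^{=S}` (`coordAvg_eq_sum_hoeffdingComp`) and
  `F − E_T F = Σ_{S ∩ T ≠ ∅} F^{=S}` (`sub_coordAvg_eq_sum`);
* `sum_sq_sub_coordAvg`, `sum_mul_coordAvg_eq` — the squared norms of these two pieces;
* `sum_sum_sq_sub_piecewise_eq` — the **resampling-sensitivity identity for a set**:
  `Σ_y Σ_z (F y − F (y with the T-coordinates replaced by those of z))² = 2 #(ι → Γ) Σ_y (F y − E_T F y)²`
  (so the probability that resampling the coordinates in `T` changes a `±1`-valued `F` is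
  `½ Σ_{S ∩ T ≠ ∅} ‖F^{=S}‖²`, the finite-alphabet form of `NS = ½ Σ_S (1 − ρ^{|S|}) f̂(S)²`);
* the **low-degree truncation** `Σ_{|S| < d} F^{=S}`: its distance from `F` is the tail
  `Σ_{|S| ≥ d} ‖F^{=S}‖²` (`sum_sq_sub_truncation_eq`), its energy is at most that of `F`
  (`sum_sq_sum_hoeffdingComp_le`), and it is a sum of juntas of size `< d`
  (`truncation_isSumOfJuntas`, the body of `Literature.Computability.Complexity.IsCoordDegreeLE`).

No new definitions (the truncation is written as the explicit sum); everything is proved.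

## References
* R. O'Donnell, *Analysis of Boolean Functions*, CUP 2014, §8.3 (Def. 8.33, Prop. 8.36,
  Thm. 8.35), §8.4, §3.1 (spectral concentration / truncation) [ODonnell2014].
* B. Efron, C. Stein, *The jackknife estimate of variance*, Ann. Statist. 9 (1981) 586–596
  [EfronStein1981].
-/

noncomputable section

namespace Literature.Probability.Moments

open Finset

variable {ι Γ : Type*} [Fintype ι] [DecidableEq ι] [Fintype Γ]

/-! ### Components are juntas; `E_T` on components -/

/-- The Hoeffding component `F^{=S}` depends only on the coordinates in `S` (each term
`E_{Rᶜ} F`, `R ⊆ S`, depends only on `R`). [cite: ODonnell2014, §8.3 Def. 8.33] -/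
theorem dependsOn_hoeffdingComp (S : Finset ι) (F : (ι → Γ) → ℝ) :
    DependsOn (hoeffdingComp S F) (↑S : Set ι) := by
  intro y y' h
  simp only [hoeffdingComp_apply]
  refine sum_congr rfl fun R hR => ?_
  congr 1
  refine dependsOn_coordAvg_compl Rᶜ F fun j hj => h j ?_
  have hjR : j ∈ R := by
    simp only [Set.mem_setOf_eq, mem_compl, not_not] at hj
    exact hj
  exact mem_powerset.1 hR hjR

/-- **`E_T` on a component** (O'Donnell 2014, Prop. 8.36): `E_T F^{=S} = F^{=S}` if `S ∩ T = ∅`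
and `E_T F^{=S} = 0` otherwise. [cite: ODonnell2014, §8.3 Prop. 8.36] -/
theorem coordAvg_hoeffdingComp [Nonempty Γ] (T S : Finset ι) (F : (ι → Γ) → ℝ) :
    coordAvg T (hoeffdingComp S F) =
      if Disjoint S T then hoeffdingComp S F else fun _ => 0 := by
  induction T using Finset.induction_on with
  | empty => rw [coordAvg_empty, if_pos (disjoint_empty_right S)]
  | @insert i T hi ih =>
    rw [insert_eq, ← coordAvg_coordAvg, ih]
    by_cases hd : Disjoint S T
    · rw [if_pos hd]
      by_cases hiS : i ∈ S
      · rw [coordAvg_singleton_hoeffdingComp_eq_zero hiS, if_neg]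
        rw [disjoint_union_right, disjoint_singleton_right]
        exact fun h => h.1 hiS
      · rw [coordAvg_singleton_hoeffdingComp_eq_self hiS, if_pos]
        rw [disjoint_union_right, disjoint_singleton_right]
        exact ⟨hiS, hd⟩
    · rw [if_neg hd, coordAvg_zero, if_neg]
      rw [disjoint_union_right]
      exact fun h => hd h.2

/-- **Noise-operator formula**: `E_T F = Σ_{S : S ∩ T = ∅} F^{=S}` — resampling the coordinates in
`T` keeps exactly the components avoiding `T` (the finite-alphabet form of
`T_ρ f = Σ_S ρ^{|S|} f̂(S) χ_S` at `ρ ∈ {0,1}` per coordinate). [cite: ODonnell2014, §8.3 Prop. 8.36] -/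
theorem coordAvg_eq_sum_hoeffdingComp [Nonempty Γ] (T : Finset ι) (F : (ι → Γ) → ℝ) (y : ι → Γ) :
    coordAvg T F y =
      ∑ S ∈ (univ : Finset ι).powerset.filter (fun S => Disjoint S T), hoeffdingComp S F y := by
  have h1 : coordAvg T F = coordAvg T (fun y => ∑ S ∈ (univ : Finset ι).powerset,
      hoeffdingComp S F y) := by
    congr 1; funext y; rw [sum_hoeffdingComp_univ]
  rw [h1, coordAvg_sum, sum_filter]
  refine sum_congr rfl fun S _ => ?_
  rw [coordAvg_hoeffdingComp]
  split_ifs <;> rfl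

/-- `F − E_T F = Σ_{S : S ∩ T ≠ ∅} F^{=S}` (the generalisation of the projection formula
`L_i f = Σ_{S ∋ i} f^{=S}` to a set of coordinates). [cite: ODonnell2014, §8.3 Prop. 8.45] -/
theorem sub_coordAvg_eq_sum [Nonempty Γ] (T : Finset ι) (F : (ι → Γ) → ℝ) (y : ι → Γ) :
    F y - coordAvg T F y =
      ∑ S ∈ (univ : Finset ι).powerset.filter (fun S => ¬ Disjoint S T), hoeffdingComp S F y := by
  have htot := sum_hoeffdingComp_univ F y
  have hsplit := sum_filter_add_sum_filter_not (univ : Finset ι).powerset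
    (fun S => Disjoint S T) (fun S => hoeffdingComp S F y)
  rw [coordAvg_eq_sum_hoeffdingComp]
  linarith

/-- **Squared norm of the moving part**: `Σ_y (F y − E_T F y)² = Σ_{S ∩ T ≠ ∅} Σ_y (F^{=S} y)²`.
[cite: ODonnell2014, §8.3 Thm. 8.35] -/
theorem sum_sq_sub_coordAvg [Nonempty Γ] (T : Finset ι) (F : (ι → Γ) → ℝ) :
    ∑ y, (F y - coordAvg T F y) ^ 2 =
      ∑ S ∈ (univ : Finset ι).powerset.filter (fun S => ¬ Disjoint S T),
        ∑ y, hoeffdingComp S F y ^ 2 := by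
  rw [← sum_sq_sum_hoeffdingComp]
  exact sum_congr rfl fun y _ => by rw [sub_coordAvg_eq_sum]

/-- **Squared norm of the fixed part** (the noise stability at `T`):
`Σ_y F y · E_T F y = Σ_{S ∩ T = ∅} Σ_y (F^{=S} y)²`. [cite: ODonnell2014, §8.3 Thm. 8.35] -/
theorem sum_mul_coordAvg_eq [Nonempty Γ] (T : Finset ι) (F : (ι → Γ) → ℝ) :
    ∑ y, F y * coordAvg T F y =
      ∑ S ∈ (univ : Finset ι).powerset.filter (fun S => Disjoint S T),
        ∑ y, hoeffdingComp S F y ^ 2 := by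
  rw [← sum_coordAvg_sq, ← sum_sq_sum_hoeffdingComp]
  exact sum_congr rfl fun y _ => by rw [coordAvg_eq_sum_hoeffdingComp]

/-! ### Resampling a set of coordinates -/

/-- Re-counting the resampled points for a set: `Σ_y Σ_z G (T.piecewise z y) = #(ι → Γ) · Σ_y G y`.
[folklore] -/
theorem sum_sum_piecewise_eq [Nonempty Γ] (T : Finset ι) (G : (ι → Γ) → ℝ) :
    ∑ y : ι → Γ, ∑ z : ι → Γ, G (T.piecewise z y) = Fintype.card (ι → Γ) * ∑ y, G y := by
  have hN : (Fintype.card (ι → Γ) : ℝ) ≠ 0 := by exact_mod_cast Fintype.card_ne_zero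
  have h : ∀ y : ι → Γ, ∑ z : ι → Γ, G (T.piecewise z y) =
      Fintype.card (ι → Γ) * coordAvg T G y := by
    intro y; rw [coordAvg_apply]; field_simp
  simp_rw [h]
  rw [← mul_sum]
  congr 1
  have := sum_coordAvg_mul T G (fun _ => (1 : ℝ))
  simp only [mul_one, coordAvg_const] at this
  exact this

/-- **Resampling-sensitivity identity for a set of coordinates** (counting form of
`E_{y,z}[(F(y) − F(y^{(T←z)}))²] = 2 ‖F − E_T F‖²`): for every `T`,
`Σ_y Σ_z (F y − F (T.piecewise z y))² = 2 #(ι → Γ) · Σ_y (F y − E_T F y)²`.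
[cite: ODonnell2014, §8.3] -/
theorem sum_sum_sq_sub_piecewise_eq [Nonempty Γ] (T : Finset ι) (F : (ι → Γ) → ℝ) :
    ∑ y : ι → Γ, ∑ z : ι → Γ, (F y - F (T.piecewise z y)) ^ 2 =
      2 * Fintype.card (ι → Γ) * ∑ y, (F y - coordAvg T F y) ^ 2 := by
  have hN : (Fintype.card (ι → Γ) : ℝ) ≠ 0 := by exact_mod_cast Fintype.card_ne_zero
  have hexp : ∀ y : ι → Γ, ∑ z : ι → Γ, (F y - F (T.piecewise z y)) ^ 2 =
      Fintype.card (ι → Γ) * F y ^ 2 - 2 * F y * (Fintype.card (ι → Γ) * coordAvg T F y) +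
        ∑ z : ι → Γ, F (T.piecewise z y) ^ 2 := by
    intro y
    have h1 : (Fintype.card (ι → Γ) : ℝ) * coordAvg T F y = ∑ z : ι → Γ, F (T.piecewise z y) := by
      rw [coordAvg_apply]; field_simp
    rw [h1]
    simp only [sub_sq, sum_add_distrib, sum_sub_distrib, sum_const, card_univ, nsmul_eq_mul,
      mul_sum]
  simp_rw [hexp]
  rw [sum_add_distrib, sum_sub_distrib, sum_sum_piecewise_eq T (fun y => F y ^ 2),
    sum_sub_coordAvg_sq]
  have h2 : ∑ y : ι → Γ, 2 * F y * (Fintype.card (ι → Γ) * coordAvg T F y) =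
      2 * Fintype.card (ι → Γ) * ∑ y, F y * coordAvg T F y := by
    rw [mul_sum]; refine sum_congr rfl fun y _ => by ring
  rw [h2, ← mul_sum]
  ring

/-- For a `±1`-valued function, the number of (point, resample) pairs on which resampling the
coordinates in `T` changes the value: `4 · #{(y,z) : g y ≠ g (T.piecewise z y)} =`
`2 #(ι → Γ) · Σ_{S ∩ T ≠ ∅} Σ_y (G^{=S} y)²` with `G = (±1)^g` — the finite-alphabet form of
`NS = ½ Σ_S (1 − ρ^{|S|}) ĝ(S)²` for resampling noise. [cite: ODonnell2014, §8.3] -/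
theorem card_resample_ne_eq [Nonempty Γ] (T : Finset ι) (g : (ι → Γ) → Bool) :
    4 * ((univ.filter fun p : (ι → Γ) × (ι → Γ) => g p.1 ≠ g (T.piecewise p.2 p.1)).card : ℝ) =
      2 * Fintype.card (ι → Γ) *
        ∑ S ∈ (univ : Finset ι).powerset.filter (fun S => ¬ Disjoint S T),
          ∑ y, hoeffdingComp S (fun y => if g y then (1 : ℝ) else -1) y ^ 2 := by
  rw [← sum_sq_sub_coordAvg, ← sum_sum_sq_sub_piecewise_eq, ← Fintype.sum_prod_type']
  rw [card_eq_sum_ones, Nat.cast_sum, sum_filter, mul_sum]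
  refine sum_congr rfl fun p _ => ?_
  by_cases h : g p.1 = g (T.piecewise p.2 p.1)
  · rw [if_neg (not_not.2 h), h]
    simp
  · rw [if_pos h]
    have h' : g (T.piecewise p.2 p.1) = !g p.1 := by
      cases h1 : g p.1 <;> cases h2 : g (T.piecewise p.2 p.1) <;> simp_all
    rw [h']
    cases g p.1 <;> norm_num

/-! ### Low-degree truncation -/

/-- **Truncation error = tail**: `Σ_y (F y − Σ_{|S| < d} F^{=S} y)² = Σ_{|S| ≥ d} Σ_y (F^{=S} y)²`.
[cite: ODonnell2014, §3.1 Prop. 3.2] -/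
theorem sum_sq_sub_truncation_eq [Nonempty Γ] (d : ℕ) (F : (ι → Γ) → ℝ) :
    ∑ y, (F y - ∑ S ∈ (univ : Finset ι).powerset.filter (fun S => S.card < d),
        hoeffdingComp S F y) ^ 2 =
      ∑ S ∈ (univ : Finset ι).powerset.filter (fun S => d ≤ S.card),
        ∑ y, hoeffdingComp S F y ^ 2 := by
  rw [← sum_sq_sum_hoeffdingComp]
  refine sum_congr rfl fun y _ => ?_
  have hsplit := sum_filter_add_sum_filter_not (univ : Finset ι).powerset
    (fun S => S.card < d) (fun S => hoeffdingComp S F y)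
  rw [sum_hoeffdingComp_univ] at hsplit
  have hf : (univ : Finset ι).powerset.filter (fun S => ¬ S.card < d) =
      (univ : Finset ι).powerset.filter (fun S => d ≤ S.card) :=
    filter_congr fun S _ => by rw [not_lt]
  rw [hf] at hsplit
  congr 1
  linarith

/-- **A partial sum of components has at most the energy of `F`** (Bessel):
`Σ_y (Σ_{S ∈ 𝒜} F^{=S} y)² ≤ Σ_y F y²`. [cite: ODonnell2014, §8.3 Thm. 8.35] -/
theorem sum_sq_sum_hoeffdingComp_le [Nonempty Γ] (𝒜 : Finset (Finset ι)) (F : (ι → Γ) → ℝ) :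
    ∑ y, (∑ S ∈ 𝒜, hoeffdingComp S F y) ^ 2 ≤ ∑ y, F y ^ 2 := by
  rw [sum_sq_sum_hoeffdingComp, sum_sq_eq_sum_hoeffdingComp_sq]
  exact sum_le_sum_of_subset_of_nonneg (fun S _ => mem_powerset.2 (subset_univ S))
    fun S _ _ => sum_nonneg fun y _ => sq_nonneg _

/-- **The truncation is a sum of small juntas**: `Σ_{|S| < d} F^{=S}` is a finite sum of functions
each depending on at most `d` coordinates (indeed `< d`) — the body of
`Literature.Computability.Complexity.IsCoordDegreeLE d`. [cite: ODonnell2014, §8.3] -/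
theorem truncation_isSumOfJuntas (d : ℕ) (F : (ι → Γ) → ℝ) :
    ∃ (𝒮 : Finset (Finset ι)) (G : Finset ι → (ι → Γ) → ℝ),
      (∀ T ∈ 𝒮, T.card ≤ d ∧ DependsOn (G T) (↑T : Set ι)) ∧
      ∀ y, (∑ S ∈ (univ : Finset ι).powerset.filter (fun S => S.card < d),
        hoeffdingComp S F y) = ∑ T ∈ 𝒮, G T y :=
  ⟨(univ : Finset ι).powerset.filter (fun S => S.card < d), fun S => hoeffdingComp S F,
    fun T hT => ⟨((mem_filter.1 hT).2).le, dependsOn_hoeffdingComp T F⟩, fun _ => rfl⟩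

/-! ### Total influence and tails (O'Donnell 2014, Prop. 3.2 on a finite product space) -/

/-- **Total `L²`-influence through the components**:
`Σ_i Σ_y (F y − E_{i} F y)² = Σ_S |S| · Σ_y (F^{=S} y)²`. [cite: ODonnell2014, §8.3 Prop. 8.45] -/
theorem sum_sum_sq_sub_coordAvg_singleton_eq [Nonempty Γ] (F : (ι → Γ) → ℝ) :
    ∑ i, ∑ y, (F y - coordAvg {i} F y) ^ 2 =
      ∑ S ∈ (univ : Finset ι).powerset, (S.card : ℝ) * ∑ y, hoeffdingComp S F y ^ 2 := by
  simp_rw [sum_sq_sub_coordAvg_singleton, sum_filter]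
  rw [sum_comm]
  refine sum_congr rfl fun S _ => ?_
  rw [sum_ite_mem, univ_inter, sum_const, nsmul_eq_mul]

/-- **Tails are bounded by total influence over the level** (O'Donnell 2014, Prop. 3.2:
`ε`-concentration up to degree `I[f]/ε`): for every `d`,
`d · Σ_{|S| ≥ d} Σ_y (F^{=S} y)² ≤ Σ_i Σ_y (F y − E_{i} F y)²`. [cite: ODonnell2014, §3.1 Prop. 3.2] -/
theorem mul_tail_le_sum_sum_sq_sub_coordAvg [Nonempty Γ] (d : ℕ) (F : (ι → Γ) → ℝ) :
    (d : ℝ) * ∑ S ∈ (univ : Finset ι).powerset.filter (fun S => d ≤ S.card),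
        ∑ y, hoeffdingComp S F y ^ 2 ≤
      ∑ i, ∑ y, (F y - coordAvg {i} F y) ^ 2 := by
  rw [sum_sum_sq_sub_coordAvg_singleton_eq, mul_sum]
  calc ∑ S ∈ (univ : Finset ι).powerset.filter (fun S => d ≤ S.card),
        (d : ℝ) * ∑ y, hoeffdingComp S F y ^ 2
      ≤ ∑ S ∈ (univ : Finset ι).powerset.filter (fun S => d ≤ S.card),
        (S.card : ℝ) * ∑ y, hoeffdingComp S F y ^ 2 := by
        refine sum_le_sum fun S hS => ?_
        exact mul_le_mul_of_nonneg_right (by exact_mod_cast (mem_filter.1 hS).2)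
          (sum_nonneg fun y _ => sq_nonneg _)
    _ ≤ _ := sum_le_sum_of_subset_of_nonneg (filter_subset _ _) fun S _ _ =>
        mul_nonneg (Nat.cast_nonneg _) (sum_nonneg fun y _ => sq_nonneg _)

/-- **Boolean form**: for `g : (ι → Γ) → Bool` and `G = (±1)^g`,
`|Γ| · d · Σ_{|S| ≥ d} ‖G^{=S}‖² ≤ 2 · Σ_i #{(y, ℓ) : g y ≠ g (y[i ↦ ℓ])}` — the tail above level `d`
is at most `2/(|Γ| d)` times the summed single-coordinate resampling counts (total influence).
[cite: ODonnell2014, §3.1 Prop. 3.2] -/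
theorem card_mul_tail_le_card_update_ne [Nonempty Γ] [DecidableEq Γ] (d : ℕ) (g : (ι → Γ) → Bool) :
    (Fintype.card Γ : ℝ) * d *
        ∑ S ∈ (univ : Finset ι).powerset.filter (fun S => d ≤ S.card),
          ∑ y, hoeffdingComp S (fun y => if g y then (1 : ℝ) else -1) y ^ 2 ≤
      2 * ∑ i : ι, ((univ.filter fun q : (ι → Γ) × Γ =>
        g q.1 ≠ g (Function.update q.1 i q.2)).card : ℝ) := by
  have h := mul_tail_le_sum_sum_sq_sub_coordAvg d (fun y => if g y then (1 : ℝ) else -1)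
  have hΓ : (0 : ℝ) < Fintype.card Γ := by exact_mod_cast Fintype.card_pos
  -- `Σ_y Σ_ℓ (G y − G (y[i ↦ ℓ]))² = 2|Γ| Σ_y (G y − E_i G y)²` and `(G y − G y')² = 4 [g y ≠ g y']`
  have hcount : ∀ i : ι, 4 * ((univ.filter fun q : (ι → Γ) × Γ =>
      g q.1 ≠ g (Function.update q.1 i q.2)).card : ℝ) =
      2 * Fintype.card Γ * ∑ y, ((if g y then (1 : ℝ) else -1) -
        coordAvg {i} (fun y => if g y then (1 : ℝ) else -1) y) ^ 2 := by
    intro i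
    rw [← sum_sum_sq_sub_update_eq, ← Fintype.sum_prod_type']
    rw [card_eq_sum_ones, Nat.cast_sum, sum_filter, mul_sum]
    refine sum_congr rfl fun q _ => ?_
    by_cases hq : g q.1 = g (Function.update q.1 i q.2)
    · rw [if_neg (not_not.2 hq), hq]
      simp
    · rw [if_pos hq]
      have h' : g (Function.update q.1 i q.2) = !g q.1 := by
        cases h1 : g q.1 <;> cases h2 : g (Function.update q.1 i q.2) <;> simp_all
      rw [h']
      cases g q.1 <;> norm_num
  have hsum : 2 * ∑ i : ι, ((univ.filter fun q : (ι → Γ) × Γ =>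
      g q.1 ≠ g (Function.update q.1 i q.2)).card : ℝ) =
      Fintype.card Γ * ∑ i, ∑ y, ((if g y then (1 : ℝ) else -1) -
        coordAvg {i} (fun y => if g y then (1 : ℝ) else -1) y) ^ 2 := by
    rw [mul_sum, mul_sum]
    refine sum_congr rfl fun i _ => ?_
    linarith [hcount i]
  rw [hsum, mul_assoc]
  exact mul_le_mul_of_nonneg_left h hΓ.le

end Literature.Probability.Moments

end
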